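import Summits.ValiantsHypothesis.ValiantsHypothesis.Theorems.MonotoneRestorationOrbitRestorationQPValueOrbitIff
import Summits.ValiantsHypothesis.ValiantsHypothesis.Theorems.MonotoneRestorationOrbitRestorationQPValueDerivationOps
import Summits.ValiantsHypothesis.ValiantsHypothesis.Theorems.MonotoneRestorationOrbitRestorationQPDepthThreeRungDefs
import HarnessLib

/-!
# Orbit-restorable polynomials form an algebra (symmetrisation in ORBIT currency, VII-b)

Route MonotoneRestoration, crux `OrbitRestorationQP` (stmt-ValiantsHypothesis-18293), namespace
`Summit.ValiantsHypothesis.ValiantsHypothesis.Theorems.ValueOrbit`.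

Combining two symmetric circuits into one can CREATE automorphisms (isomorphic sub-circuits get swapped),
so the orbit size `ORB` of a naive sum/product circuit is not controlled by the orbit sizes of the parts
(g0's wall W1).  In value-orbit form the difficulty evaporates: go to value derivations
(`SymmetricValues.exists_valueDerivation_of_symmetric`), merge them as sets of values
(`…ValueDerivationOps.lean`), and come back (`ValueOrbit.qpOrbit_of_valueDerivation`).

* `exists_valueDerivation_of_qpOrbitRestorable` — the converse in line vocabulary;
* `qpOrbitRestorable_add`, `…_mul`, `…_smul` — **the `QPOrbitRestorable` polynomials at level `n` with
  constant `c` (line vocabulary, `…DepthThreeRungDefs.lean`) are closed under sum, product and scalars at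
  the cost `c ↦ c + 3`**.

Everything is proved. [folklore]

## References
* A. Dawar, G. Wilsenach, *Symmetric arithmetic circuits*, ToC 21 (2025), §3.3. [DawarWilsenach2025]
-/

noncomputable section

open scoped Classical

-- `Summit.ValiantsHypothesis.ValiantsHypothesis.…` is the tree's single-conjunct layout (Sub = Summit).
set_option linter.dupNamespace false

namespace Summit.ValiantsHypothesis.ValiantsHypothesis.Theorems

universe u v

namespace ValueOrbit

open Literature.Computability.AlgebraicComplexity OrbitRestorationQPDepthThreeRung

/-- **From a quasi-polynomial-orbit symmetric circuit to a value derivation** (the converse, in line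
vocabulary): the computed polynomial is invariant and has a value derivation with value orbits
`≤ 2^((log₂ n + c)^c)`. [folklore] -/
theorem exists_valueDerivation_of_qpOrbitRestorable {c n : ℕ} {p : MvPolynomial (Fin n × Fin n) ℂ}
    (hp : QPOrbitRestorable c n p) :
    (∀ σ : Equiv.Perm (Fin n), ren σ p = p) ∧ ∃ 𝒟 : ValueDerivation ℂ (Fin n × Fin n), p ∈ 𝒟.S ∧
      ∀ q ∈ 𝒟.S, (Set.range fun σ : Equiv.Perm (Fin n) => ren σ q).ncard ≤ 2 ^ ((Nat.log 2 n + c) ^ c) := by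
  obtain ⟨G, inst, C, hC, hev, horb⟩ := hp
  refine ⟨fun σ => ?_, ?_⟩
  · rw [← hev]; exact hC.rename_eval_output_unit σ
  · obtain ⟨𝒟, hf, hS⟩ := SymmetricValues.exists_valueDerivation_of_symmetric C hC
    exact ⟨𝒟, hev ▸ hf, fun q hq => (hS q hq).trans horb⟩

/-- An invariant polynomial has a one-point orbit. [folklore] -/
theorem ncard_orbit_of_invariant {n : ℕ} {p : MvPolynomial (Fin n × Fin n) ℂ}
    (hp : ∀ σ : Equiv.Perm (Fin n), ren σ p = p) :
    (Set.range fun σ : Equiv.Perm (Fin n) => ren σ p).ncard ≤ 1 := by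
  rw [show (Set.range fun σ : Equiv.Perm (Fin n) => ren σ p) = {p} from ?_]
  · rw [Set.ncard_singleton]
  · ext q
    simp only [Set.mem_range, hp, Set.mem_singleton_iff, exists_const, eq_comm]

/-- **`QPOrbitRestorable` is closed under sums** (cost `c ↦ c + 3`). [folklore] -/
theorem qpOrbitRestorable_add {c n : ℕ} {p q : MvPolynomial (Fin n × Fin n) ℂ}
    (hp : QPOrbitRestorable c n p) (hq : QPOrbitRestorable c n q) : QPOrbitRestorable (c + 3) n (p + q) := by
  obtain ⟨hpi, 𝒟₁, hp1, hS1⟩ := exists_valueDerivation_of_qpOrbitRestorable hp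
  obtain ⟨hqi, 𝒟₂, hq2, hS2⟩ := exists_valueDerivation_of_qpOrbitRestorable hq
  have hB : 1 ≤ 2 ^ ((Nat.log 2 n + c) ^ c) := Nat.one_le_two_pow
  have hfix : ∀ σ : Equiv.Perm (Fin n), ren σ (p + q) = p + q := fun σ => by rw [map_add, hpi, hqi]
  have hp' : p ∈ (𝒟₁.union 𝒟₂).S := ValueDerivation.mem_union_S_left hp1
  have hq' : q ∈ (𝒟₁.union 𝒟₂).S := ValueDerivation.mem_union_S_right hq2
  unfold QPOrbitRestorable
  refine qpOrbit_of_valueDerivation ((𝒟₁.union 𝒟₂).addStep p q hp' hq') (f := p + q)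
    (ValueDerivation.mem_addStep_S.2 (Or.inl rfl)) hfix ?_
  · intro r hr
    rcases ValueDerivation.mem_addStep_S.1 hr with rfl | hr
    · exact (ncard_orbit_of_invariant hfix).trans hB
    rcases ValueDerivation.mem_union_S.1 hr with hr | hr
    · exact hS1 r hr
    · exact hS2 r hr

/-- **`QPOrbitRestorable` is closed under products** (cost `c ↦ c + 3`). [folklore] -/
theorem qpOrbitRestorable_mul {c n : ℕ} {p q : MvPolynomial (Fin n × Fin n) ℂ}
    (hp : QPOrbitRestorable c n p) (hq : QPOrbitRestorable c n q) : QPOrbitRestorable (c + 3) n (p * q) := by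
  obtain ⟨hpi, 𝒟₁, hp1, hS1⟩ := exists_valueDerivation_of_qpOrbitRestorable hp
  obtain ⟨hqi, 𝒟₂, hq2, hS2⟩ := exists_valueDerivation_of_qpOrbitRestorable hq
  have hB : 1 ≤ 2 ^ ((Nat.log 2 n + c) ^ c) := Nat.one_le_two_pow
  have hfix : ∀ σ : Equiv.Perm (Fin n), ren σ (p * q) = p * q := fun σ => by rw [map_mul, hpi, hqi]
  have hp' : p ∈ (𝒟₁.union 𝒟₂).S := ValueDerivation.mem_union_S_left hp1
  have hq' : q ∈ (𝒟₁.union 𝒟₂).S := ValueDerivation.mem_union_S_right hq2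
  unfold QPOrbitRestorable
  refine qpOrbit_of_valueDerivation ((𝒟₁.union 𝒟₂).mulStep p q hp' hq') (f := p * q)
    (ValueDerivation.mem_mulStep_S.2 (Or.inl rfl)) hfix ?_
  · intro r hr
    rcases ValueDerivation.mem_mulStep_S.1 hr with rfl | hr
    · exact (ncard_orbit_of_invariant hfix).trans hB
    rcases ValueDerivation.mem_union_S.1 hr with hr | hr
    · exact hS1 r hr
    · exact hS2 r hr

/-- **`QPOrbitRestorable` is closed under scalars** (cost `c ↦ c + 3`). [folklore] -/
theorem qpOrbitRestorable_smul {c n : ℕ} {p : MvPolynomial (Fin n × Fin n) ℂ} (a : ℂ)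
    (hp : QPOrbitRestorable c n p) : QPOrbitRestorable (c + 3) n (MvPolynomial.C a * p) := by
  obtain ⟨hpi, 𝒟₁, hp1, hS1⟩ := exists_valueDerivation_of_qpOrbitRestorable hp
  have hB : 1 ≤ 2 ^ ((Nat.log 2 n + c) ^ c) := Nat.one_le_two_pow
  have hfix : ∀ σ : Equiv.Perm (Fin n), ren σ (MvPolynomial.C a * p) = MvPolynomial.C a * p := fun σ => by
    rw [map_mul, ren_C, hpi]
  unfold QPOrbitRestorable
  refine qpOrbit_of_valueDerivation (𝒟₁.smulStep a p hp1) (f := MvPolynomial.C a * p)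
    (ValueDerivation.mem_smulStep_S.2 (Or.inl rfl)) hfix ?_
  intro r hr
  rcases ValueDerivation.mem_smulStep_S.1 hr with rfl | hr
  · exact (ncard_orbit_of_invariant hfix).trans hB
  · exact hS1 r hr

end ValueOrbit

end Summit.ValiantsHypothesis.ValiantsHypothesis.Theorems

end
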